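import Mathlib.AlgebraicGeometry.EllipticCurve.Affine.Point
import Mathlib.GroupTheory.QuotientGroup.Basic
import Literature.RingTheory.DiscreteValuationRing.AdicCompletionHensel
import HarnessLib

/-!
# `E(K_v)/E₀(K_v)` for `y² + xy = x³ + a₆`: `ord_v(a₆)` pairwise incongruent points

Third file of the series proving the named fact
`Literature.NumberTheory.EllipticCurves.rationalComponents_eq_card_of_hasSplitMultiplicativeReductionAt` (`NeronModel`,
`NeronModelProofs`). For a Weierstrass equation over the completion `K_v` in *Tate normal form*
`T : y² + xy = x³ + a₆`, `a₆ = αϖⁿ` (`α ∈ O_vˣ`, `ϖ` a uniformiser, `n ≥ 1`; this is the shape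
of the Tate curve `E_q`, Silverman, *ATAEC*, V.3, and every split multiplicative minimal model is
`O_v`-isomorphic to such a `T` with `n = ord_v(Δ_min)`,
`Literature.NumberTheory.EllipticCurves.SplitMultiplicativeNormalForm`), we prove by elementary
valuation estimates, in the style of Silverman, *ATAEC*, V.4, Lemmas 4.1.1–4.1.4:

* `Literature.NumberTheory.EllipticCurves.TateNormalForm.IsBig`, `bigSubgroup`: the points `𝒪` and `(x, y)` with `|x| ≥ 1` (the
  points not reducing to the node `(0, 0)`; for a minimal `T` these are the points of `E₀(K_v)`,
  *ATAEC*, Lemma V.4.1.1) form a subgroup — the computational content of "`E₀(K)` is a subgroup"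
  (Silverman, *AEC*, Prop. VII.2.1) for the normal form: `not_isBig_add_of_isBig_of_not_isBig`
  (big + small = small), `isBig_add`;
* `Literature.NumberTheory.EllipticCurves.TateNormalForm.exists_fin_forall_isBig_sub_imp_eq`: there are `n` points of `T(K_v)`
  whose pairwise differences are not big, namely `𝒪`, `Q_m = (ϖᵐ, ϖᵐz_m)` and `−Q_m`
  (`1 ≤ m < n/2`, `z_m ∈ 𝔪_v` from Hensel's lemma) and, for `n` even, `Q_W = (ϖ^{n/2}w, ϖ^{n/2})`
  (non-monic Hensel's lemma of `Literature.RingTheory.DiscreteValuationRing.AdicCompletionHensel`);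
  the differences are controlled by the chord and tangent tests `not_isBig_add_of_v_slope`,
  `not_isBig_two_smul_of_v_slope` (a chord of slope `λ` with `|λ| < 1` or `|λ + 1| < 1` through
  two small points meets the curve again in a small point). Hence (`exists_fin_injective_quotient`)
  `Fin n` injects into `T(K_v)/B` for every subgroup `B` of big points.

This is the lower bound `#E(K_v)/E₀(K_v) ≥ n` of the theorem of Kodaira–Néron and Tate
(`E(K)/E₀(K)` cyclic of order `n = v(Δ) = −v(j)` for split multiplicative reduction: Silverman,
*ATAEC*, Cor. IV.9.2(d), Rem. IV.9.6; *AEC*, Thm. VII.6.1); the upper bound is *ATAEC*,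
Prop. V.4.1 and is not needed for the named fact (see `NeronModelProofs`). No hypothesis on the
residue field is used.

Throughout, `|·|` is Mathlib's multiplicative valuation `Valued.v` of `K_v` (values in
`ℤᵐ⁰`), so that `O_v = {|x| ≤ 1}` and `𝔪_v = {|x| < 1}`; in the Lean names `v_…` refers to it.

## References

* J. H. Silverman, *Advanced Topics in the Arithmetic of Elliptic Curves*, GTM 151, Springer
  1994: Cor. IV.9.2(d) (PDF p. 340), Rem. IV.9.6 (PDF p. 355), V.3 Thm. 3.1 (PDF p. 394),
  V.4 Prop. 4.1 and Lemmas 4.1.1–4.1.4 (PDF pp. 402–405).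
* J. H. Silverman, *The Arithmetic of Elliptic Curves*, 2nd ed., GTM 106, Springer 2009,
  Prop. VII.2.1 and Thm. VII.6.1.
-/

noncomputable section

open scoped Classical

open IsDedekindDomain IsLocalRing

namespace Literature.NumberTheory.EllipticCurves

namespace TateNormalForm

variable {A : Type*} [CommRing A] [IsDedekindDomain A] {K : Type*} [Field K] [Algebra A K]
  [IsFractionRing A K] {v : HeightOneSpectrum A}

/-! ### Valuation bookkeeping on `O_v ⊆ K_v` -/

section Valuation

variable (K v)

/-- `O_v` is the ring of integers of `Valued.v` on `K_v` (Mathlib's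
`Valuation.valuationSubring.integers`, restated for `adicCompletionIntegers`). [folklore] -/
theorem integers_adicCompletionIntegers :
    (Valued.v : Valuation (v.adicCompletion K) _).Integers (v.adicCompletionIntegers K) :=
  Valuation.valuationSubring.integers _

variable {K v}

/-- Elements of `O_v` have `|x| ≤ 1`. [folklore] -/
theorem v_coe_le_one (x : v.adicCompletionIntegers K) :
    Valued.v (x : v.adicCompletion K) ≤ 1 :=
  (integers_adicCompletionIntegers K v).map_le_one x

/-- `x ∈ 𝔪_v ↔ |x| < 1` for `x ∈ O_v`. [folklore] -/
theorem mem_maximalIdeal_iff_v_lt_one (x : v.adicCompletionIntegers K) :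
    x ∈ maximalIdeal (v.adicCompletionIntegers K) ↔ Valued.v (x : v.adicCompletion K) < 1 := by
  rw [mem_maximalIdeal, mem_nonunits_iff,
    (integers_adicCompletionIntegers K v).isUnit_iff_valuation_eq_one]
  exact ⟨fun h => lt_of_le_of_ne (v_coe_le_one x) h, fun h => h.ne⟩

/-- An element of `K_v` with `|x| ≤ 1` lies in `O_v`. [folklore] -/
theorem exists_coe_eq_of_v_le_one {x : v.adicCompletion K} (hx : Valued.v x ≤ 1) :
    ∃ x₀ : v.adicCompletionIntegers K, (x₀ : v.adicCompletion K) = x :=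
  ⟨⟨x, (HeightOneSpectrum.mem_adicCompletionIntegers A K v).mpr hx⟩, rfl⟩

/-- `|2| ≤ 1`. [folklore] -/
theorem v_two_le_one : Valued.v (2 : v.adicCompletion K) ≤ 1 := by
  rw [← one_add_one_eq_two]
  exact Valuation.map_add_le _ (le_of_eq (Valuation.map_one _)) (le_of_eq (Valuation.map_one _))

/-- In a linearly ordered commutative group with zero: `a ≤ c`, `b < 1`, `0 < c` give `a·b < c`.
[folklore] -/
theorem mul_lt_of_le_of_lt_one₀ {Γ₀ : Type*} [LinearOrderedCommGroupWithZero Γ₀] {a b c : Γ₀}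
    (hc : 0 < c) (ha : a ≤ c) (hb : b < 1) : a * b < c := by
  rcases eq_or_ne a 0 with rfl | ha0
  · rwa [zero_mul]
  · calc a * b < a * 1 := mul_lt_mul_of_pos_left hb (zero_lt_iff.mpr ha0)
      _ = a := mul_one a
      _ ≤ c := ha

end Valuation

/-! ### The normal form and its big points -/

section NormalForm

variable (T : WeierstrassCurve (v.adicCompletion K))

/-- `T` is in *Tate normal form*: `y² + xy = x³ + a₆` with `|a₆| < 1`, i.e. `a₁ = 1`,
`a₂ = a₃ = a₄ = 0` and `a₆ ∈ 𝔪_v` (the shape of the Tate curve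
`E_q : y² + xy = x³ + a₄x + a₆`, `|a₆| < 1`, of Silverman, *ATAEC*, V.3, with `a₄ = 0`; every
split multiplicative minimal equation over `O_v` can be brought to this shape,
`Literature.NumberTheory.EllipticCurves.SplitMultiplicativeNormalForm`). Its reduction is the
nodal cubic `y² + xy = x³` with node `(0, 0)`. [folklore] -/
structure IsTateNormalForm : Prop where
  a₁ : T.a₁ = 1
  a₂ : T.a₂ = 0
  a₃ : T.a₃ = 0
  a₄ : T.a₄ = 0
  v_a₆ : Valued.v T.a₆ < 1

variable {T}

/-- The equation of a curve in Tate normal form: `y² + xy = x³ + a₆`. [folklore] -/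
theorem IsTateNormalForm.equation_iff (hT : IsTateNormalForm T) (x y : v.adicCompletion K) :
    T.toAffine.Equation x y ↔ y ^ 2 + x * y = x ^ 3 + T.a₆ := by
  rw [WeierstrassCurve.Affine.equation_iff, hT.a₁, hT.a₂, hT.a₃, hT.a₄]
  constructor <;> intro h <;> linear_combination h

/-- `negY` in Tate normal form: `-(x, y) = (x, -y - x)`. [folklore] -/
theorem IsTateNormalForm.negY (hT : IsTateNormalForm T) (x y : v.adicCompletion K) :
    T.toAffine.negY x y = -y - x := by
  rw [WeierstrassCurve.Affine.negY, hT.a₁, hT.a₃]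
  ring

/-- `addX` in Tate normal form: `x(P + Q) = λ² + λ − x₁ − x₂`. [folklore] -/
theorem IsTateNormalForm.addX (hT : IsTateNormalForm T) (x₁ x₂ L : v.adicCompletion K) :
    T.toAffine.addX x₁ x₂ L = L ^ 2 + L - x₁ - x₂ := by
  rw [WeierstrassCurve.Affine.addX, hT.a₁, hT.a₂]
  ring

variable (T) in
/-- A point of `T(K_v)` is *big* if it is `𝒪` or its `x`-coordinate has `|x| ≥ 1`
(`Valued.v x ≥ 1`, i.e. `ord_v(x) ≤ 0`), i.e. it does not reduce to the singular point
`(0, 0)` of the reduction `y² + xy = x³` of the normal form: for a minimal equation in Tate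
normal form these are exactly the points of `E₀(K_v)` (Silverman, *ATAEC*, V.4, Lemma 4.1.1:
on `E_q`, `P ∈ E_{q,0}(K) ⟺ |x(P)| ≥ 1 ⟺ |y(P)| ≥ 1`, whose proof only uses that the
reduction is `y² + xy = x³` with singular point `(0, 0)`).
[cite: SilvermanATAEC1994, Lemma V.4.1.1 (PDF p. 402)] -/
def IsBig : T.toAffine.Point → Prop
  | .zero => True
  | @WeierstrassCurve.Affine.Point.some _ _ _ x _ _ => 1 ≤ Valued.v x

/-- `𝒪` is big (by definition). [folklore] -/
@[simp]
theorem isBig_zero : IsBig T 0 := trivial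

/-- An affine point is big iff `|x| ≥ 1` (by definition). [folklore] -/
@[simp]
theorem isBig_some {x y : v.adicCompletion K} (h : T.toAffine.Nonsingular x y) :
    IsBig T (.some x y h) ↔ 1 ≤ Valued.v x := Iff.rfl

/-- On `y² + xy = x³ + a₆` with `|a₆| < 1`, a point with `|x| < 1` has `|y| < 1`
(if `|y| ≥ 1` then `y²` strictly dominates `xy`, `x³`, `a₆`). Silverman, *ATAEC*, V.4,
Lemma 4.1.1. [cite: SilvermanATAEC1994, Lemma V.4.1.1 (PDF p. 402)] -/
theorem v_y_lt_one_of_v_x_lt_one (hT : IsTateNormalForm T)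
    {x y : v.adicCompletion K} (h : T.toAffine.Equation x y) (hx : Valued.v x < 1) :
    Valued.v y < 1 := by
  have ha := hT.v_a₆
  by_contra hy
  rw [not_lt] at hy
  rw [hT.equation_iff] at h
  set V : Valuation (v.adicCompletion K) _ := Valued.v with hV
  have hy0 : 0 < V y := lt_of_lt_of_le zero_lt_one hy
  have h1 : V (x * y) < V (y ^ 2) := by
    rw [Valuation.map_mul, Valuation.map_pow, sq]
    calc V x * V y < 1 * V y := mul_lt_mul_of_pos_right (hx) hy0
      _ = V y := one_mul _
      _ ≤ V y * V y := le_mul_of_one_le_left (le_of_lt hy0) hy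
  have h2 : V (x ^ 3 + T.a₆) < V (y ^ 2) := by
    refine Valuation.map_add_lt _ ?_ ?_
    · rw [Valuation.map_pow, Valuation.map_pow]
      calc V x ^ 3 < 1 := pow_lt_one₀ zero_le hx three_ne_zero
        _ ≤ V y ^ 2 := one_le_pow₀ hy
    · rw [Valuation.map_pow]
      exact lt_of_lt_of_le ha (one_le_pow₀ hy)
  have h3 : V (y ^ 2 + x * y) = V (y ^ 2) := Valuation.map_add_eq_of_lt_left _ h1
  rw [h] at h3
  exact h2.ne h3

/-- On `y² + xy = x³ + a₆` with `|a₆| ≤ 1`, a point with `|x| ≥ 1` has `|y| ≤ |x|²`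
(if `|y| > |x|²` then `y²` strictly dominates). [folklore] -/
theorem v_y_le_sq_of_one_le_v_x (hT : IsTateNormalForm T)
    {x y : v.adicCompletion K} (h : T.toAffine.Equation x y) (hx : 1 ≤ Valued.v x) :
    Valued.v y ≤ Valued.v x ^ 2 := by
  have ha := hT.v_a₆.le
  by_contra hy
  rw [not_le] at hy
  rw [hT.equation_iff] at h
  set V : Valuation (v.adicCompletion K) _ := Valued.v with hV
  have hx0 : 0 < V x := lt_of_lt_of_le zero_lt_one hx
  have hx1 : 1 ≤ V x ^ 2 := one_le_pow₀ hx
  have hy1 : 1 < V y := lt_of_le_of_lt hx1 hy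
  have hy0 : 0 < V y := lt_trans zero_lt_one hy1
  have hxy : V x < V y := by
    calc V x ≤ V x ^ 2 := le_self_pow₀ hx two_ne_zero
      _ < V y := hy
  have h1 : V (x * y) < V (y ^ 2) := by
    rw [Valuation.map_mul, Valuation.map_pow, sq]
    exact mul_lt_mul_of_pos_right hxy hy0
  have h2 : V (x ^ 3 + T.a₆) < V (y ^ 2) := by
    refine Valuation.map_add_lt _ ?_ ?_
    · rw [Valuation.map_pow, Valuation.map_pow]
      calc V x ^ 3 ≤ V x ^ 4 := pow_le_pow_right₀ hx (by norm_num)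
        _ = (V x ^ 2) ^ 2 := by rw [← pow_mul]
        _ < V y ^ 2 := pow_lt_pow_left₀ hy zero_le two_ne_zero
    · rw [Valuation.map_pow]
      exact lt_of_le_of_lt ha (one_lt_pow₀ hy1 two_ne_zero)
  have h3 : V (y ^ 2 + x * y) = V (y ^ 2) := Valuation.map_add_eq_of_lt_left _ h1
  rw [h] at h3
  exact h2.ne h3

/-! ### `E₀` is a subgroup: big plus small is small (Silverman, *AEC*, VII.2.1) -/

/-- **Key estimate.** On `y² + xy = x³ + a₆`, `|a₆| < 1`: if `P = (x₁, y₁)` is big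
(`|x₁| ≥ 1`) and `R = (x₂, y₂)` is small (`|x₂| < 1`, hence `|y₂| < 1`), then `P + R` is small.
With `λ = N/D`, `N = y₁ − y₂`, `D = x₁ − x₂` (`|D| = |x₁|`), the two curve equations give
`(x(P + R) + x₂)·D² = N² + ND − x₁D² = 2a₆ + x₂³ − 2y₁y₂ − y₁x₂ − y₂x₁ + 2x₁²x₂ − x₁x₂²`, and
each term on the right has absolute value `< |x₁|²` (using `|y₁| ≤ |x₁|²`), so
`|x(P + R) + x₂| < 1`. This is the computational heart of "`E₀(K)` is a subgroup of `E(K)`"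
(Silverman, *AEC*, Prop. VII.2.1) for the normal form, done with valuations instead of the
reduction map. [cite: SilvermanAEC2009, Prop. VII.2.1] -/
theorem not_isBig_add_of_isBig_of_not_isBig (hT : IsTateNormalForm T) {P R : T.toAffine.Point}
    (hP : IsBig T P) (hP0 : P ≠ 0) (hR : ¬IsBig T R) : ¬IsBig T (P + R) := by
  rcases P with _ | ⟨x₁, y₁, h₁⟩
  · exact absurd rfl hP0
  rcases R with _ | ⟨x₂, y₂, h₂⟩
  · exact absurd isBig_zero hR
  simp only [isBig_some, not_le] at hP hR
  set V : Valuation (v.adicCompletion K) _ := Valued.v with hV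
  have hxlt : V x₂ < V x₁ := lt_of_lt_of_le hR hP
  have hx : x₁ ≠ x₂ := fun e => by rw [e] at hxlt; exact lt_irrefl _ hxlt
  rw [WeierstrassCurve.Affine.Point.add_of_X_ne hx, isBig_some, not_le, hT.addX,
    WeierstrassCurve.Affine.slope_of_X_ne hx]
  set N := y₁ - y₂ with hN
  set D := x₁ - x₂ with hD
  set L := N / D with hL
  have hD0 : D ≠ 0 := sub_ne_zero.mpr hx
  have hLD : L * D = N := div_mul_cancel₀ N hD0
  have hVD : V D = V x₁ := Valuation.map_sub_eq_of_lt_left _ hxlt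
  have e1 := (hT.equation_iff x₁ y₁).mp h₁.1
  have e2 := (hT.equation_iff x₂ y₂).mp h₂.1
  have key : (L ^ 2 + L - x₁) * D ^ 2 = 2 * T.a₆ + x₂ ^ 3 - 2 * y₁ * y₂ - y₁ * x₂ - y₂ * x₁
      + 2 * x₁ ^ 2 * x₂ - x₁ * x₂ ^ 2 := by
    linear_combination (L * D + N + D) * hLD + e1 + e2
  -- valuations of the seven terms
  have hX1 : 1 ≤ V x₁ := hP
  have hX0 : 0 < V x₁ ^ 2 := pow_pos (lt_of_lt_of_le zero_lt_one hX1) 2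
  have hXX : V x₁ ≤ V x₁ ^ 2 := le_self_pow₀ hX1 two_ne_zero
  have hY1 : V y₁ ≤ V x₁ ^ 2 := v_y_le_sq_of_one_le_v_x hT h₁.1 hP
  have hy₂ : V y₂ < 1 := v_y_lt_one_of_v_x_lt_one hT h₂.1 hR
  have h2 : V (2 : v.adicCompletion K) ≤ 1 := v_two_le_one
  have t1 : V (2 * T.a₆) < V x₁ ^ 2 := by
    rw [Valuation.map_mul]
    calc V 2 * V T.a₆ ≤ 1 * V T.a₆ := mul_le_mul_left h2 _
      _ = V T.a₆ := one_mul _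
      _ < 1 := hT.v_a₆
      _ ≤ V x₁ ^ 2 := one_le_pow₀ hX1
  have t2 : V (x₂ ^ 3) < V x₁ ^ 2 := by
    rw [Valuation.map_pow]
    exact lt_of_lt_of_le (pow_lt_one₀ zero_le hR three_ne_zero) (one_le_pow₀ hX1)
  have t3 : V (2 * y₁ * y₂) < V x₁ ^ 2 := by
    rw [Valuation.map_mul, Valuation.map_mul]
    calc V 2 * V y₁ * V y₂ ≤ 1 * V y₁ * V y₂ :=
          mul_le_mul_left (mul_le_mul_left h2 _) _
      _ = V y₁ * V y₂ := by rw [one_mul]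
      _ < V x₁ ^ 2 := mul_lt_of_le_of_lt_one₀ hX0 hY1 hy₂
  have t4 : V (y₁ * x₂) < V x₁ ^ 2 := by
    rw [Valuation.map_mul]
    exact mul_lt_of_le_of_lt_one₀ hX0 hY1 hR
  have t5 : V (y₂ * x₁) < V x₁ ^ 2 := by
    rw [Valuation.map_mul, mul_comm]
    exact mul_lt_of_le_of_lt_one₀ hX0 hXX hy₂
  have t6 : V (2 * x₁ ^ 2 * x₂) < V x₁ ^ 2 := by
    rw [Valuation.map_mul, Valuation.map_mul, Valuation.map_pow]
    calc V 2 * V x₁ ^ 2 * V x₂ ≤ 1 * V x₁ ^ 2 * V x₂ :=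
          mul_le_mul_left (mul_le_mul_left h2 _) _
      _ = V x₁ ^ 2 * V x₂ := by rw [one_mul]
      _ < V x₁ ^ 2 := mul_lt_of_le_of_lt_one₀ hX0 le_rfl hR
  have t7 : V (x₁ * x₂ ^ 2) < V x₁ ^ 2 := by
    rw [Valuation.map_mul, Valuation.map_pow]
    exact mul_lt_of_le_of_lt_one₀ hX0 hXX (pow_lt_one₀ zero_le hR two_ne_zero)
  have hrhs : V ((L ^ 2 + L - x₁) * D ^ 2) < V x₁ ^ 2 := by
    rw [key]
    exact Valuation.map_sub_lt _ (Valuation.map_add_lt _ (Valuation.map_sub_lt _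
      (Valuation.map_sub_lt _ (Valuation.map_sub_lt _ (Valuation.map_add_lt _ t1 t2) t3) t4)
      t5) t6) t7
  have hsmall : V (L ^ 2 + L - x₁) < 1 := by
    rw [Valuation.map_mul, Valuation.map_pow, hVD] at hrhs
    by_contra hge
    rw [not_lt] at hge
    have : V x₁ ^ 2 ≤ V (L ^ 2 + L - x₁) * V x₁ ^ 2 := le_mul_of_one_le_left zero_le hge
    exact (lt_irrefl _) (lt_of_le_of_lt this hrhs)
  have e : L ^ 2 + L - x₁ - x₂ = (L ^ 2 + L - x₁) - x₂ := by ring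
  rw [e]
  exact Valuation.map_sub_lt _ hsmall hR

/-- Negation preserves bigness (`-(x, y) = (x, -y - x)` has the same `x`). [folklore] -/
theorem isBig_neg {P : T.toAffine.Point} (h : IsBig T P) : IsBig T (-P) := by
  rcases P with _ | ⟨x, y, hP⟩
  · exact isBig_zero
  · rw [WeierstrassCurve.Affine.Point.neg_some]
    exact h

/-- Bigness is stable under negation (iff form). [folklore] -/
@[simp]
theorem isBig_neg_iff {P : T.toAffine.Point} : IsBig T (-P) ↔ IsBig T P :=
  ⟨fun h => by simpa only [neg_neg] using isBig_neg h, isBig_neg⟩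

/-- **The big points form a subgroup** (Silverman, *AEC*, Prop. VII.2.1: `E₀(K)` is a subgroup
of `E(K)`), for the normal form `y² + xy = x³ + a₆`, `|a₆| < 1`: if `P, Q` are big and `P + Q`
were small, then `Q = −P + (P + Q)` would be small by
`not_isBig_add_of_isBig_of_not_isBig`. [cite: SilvermanAEC2009, Prop. VII.2.1] -/
theorem isBig_add (hT : IsTateNormalForm T) {P Q : T.toAffine.Point} (hP : IsBig T P)
    (hQ : IsBig T Q) : IsBig T (P + Q) := by
  by_contra hPQ
  rcases eq_or_ne P 0 with rfl | hP0
  · rw [zero_add] at hPQ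
    exact hPQ hQ
  have h1 := not_isBig_add_of_isBig_of_not_isBig hT (isBig_neg hP) (neg_ne_zero.mpr hP0) hPQ
  rw [neg_add_cancel_left] at h1
  exact h1 hQ

/-- The subgroup `E₀ = {𝒪} ∪ {(x, y) : |x| ≥ 1}` of big points of a curve in Tate normal form
over `K_v` (Silverman, *AEC*, VII.2, `E₀(K)`; *ATAEC*, V.4, `E_{q,0}(K)` and Lemma V.4.1.1).
[cite: SilvermanATAEC1994, Lemma V.4.1.1 (PDF p. 402)] -/
def bigSubgroup (hT : IsTateNormalForm T) : AddSubgroup T.toAffine.Point where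
  carrier := {P | IsBig T P}
  add_mem' {P Q} (hP : IsBig T P) (hQ : IsBig T Q) := isBig_add hT hP hQ
  zero_mem' := show IsBig T 0 from isBig_zero
  neg_mem' {P} (hP : IsBig T P) := isBig_neg hP

/-- Membership in `bigSubgroup` is `IsBig` (by definition). [folklore] -/
@[simp]
theorem mem_bigSubgroup_iff (hT : IsTateNormalForm T) (P : T.toAffine.Point) :
    P ∈ bigSubgroup hT ↔ IsBig T P := Iff.rfl

/-! ### Chord and tangent tests -/

/-- If `|L| < 1` or `|L + 1| < 1` then `|L² + L| < 1` (`L² + L = L(L + 1)` and the other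
factor has `|·| ≤ 1`). [folklore] -/
theorem v_sq_add_self_lt_one {L : v.adicCompletion K}
    (hL : Valued.v L < 1 ∨ Valued.v (L + 1) < 1) : Valued.v (L ^ 2 + L) < 1 := by
  have e : L ^ 2 + L = L * (L + 1) := by ring
  rw [e, Valuation.map_mul]
  rcases hL with h | h
  · have h' : Valued.v (L + 1) ≤ 1 :=
      Valuation.map_add_le _ h.le (le_of_eq (Valuation.map_one _))
    calc Valued.v L * Valued.v (L + 1) ≤ Valued.v L * 1 := mul_le_mul_right h' _
      _ < 1 := by rwa [mul_one]
  · have h' : Valued.v L ≤ 1 := by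
      have e' : L = (L + 1) - 1 := by ring
      rw [e']
      exact Valuation.map_sub_le _ h.le (le_of_eq (Valuation.map_one _))
    calc Valued.v L * Valued.v (L + 1) ≤ 1 * Valued.v (L + 1) := mul_le_mul_left h' _
      _ < 1 := by rwa [one_mul]

/-- **Chord test.** For two affine points `(x₁, y₁)`, `(x₂, y₂)` of `T` with `|x₁|, |x₂| < 1`,
`x₁ ≠ x₂`, whose chord has slope `λ` with `|λ| < 1` or `|λ + 1| < 1`, the sum is small:
`x(P₁ + P₂) = λ² + λ − x₁ − x₂` has `|·| < 1`. (The chord computations of Silverman, *ATAEC*,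
V.4, Lemma 4.1.4, run in reverse.) [folklore] -/
theorem not_isBig_add_of_v_slope (hT : IsTateNormalForm T) {x₁ y₁ x₂ y₂ : v.adicCompletion K}
    {h₁ : T.toAffine.Nonsingular x₁ y₁} {h₂ : T.toAffine.Nonsingular x₂ y₂}
    (hx₁ : Valued.v x₁ < 1) (hx₂ : Valued.v x₂ < 1) (hne : x₁ ≠ x₂)
    (hΛ : Valued.v ((y₁ - y₂) / (x₁ - x₂)) < 1 ∨ Valued.v ((y₁ - y₂) / (x₁ - x₂) + 1) < 1) :
    ¬IsBig T (.some _ _ h₁ + .some _ _ h₂) := by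
  rw [WeierstrassCurve.Affine.Point.add_of_X_ne hne, isBig_some, not_le, hT.addX,
    WeierstrassCurve.Affine.slope_of_X_ne hne]
  exact Valuation.map_sub_lt _ (Valuation.map_sub_lt _ (v_sq_add_self_lt_one hΛ) hx₁) hx₂

/-- **Tangent test.** For an affine point `(x, y)` of `T` with `|x| < 1`, `2y + x ≠ 0`, whose
tangent has slope `λ = (3x² − y)/(2y + x)` with `|λ| < 1` or `|λ + 1| < 1`, the double is small:
`x(2P) = λ² + λ − 2x`. [folklore] -/
theorem not_isBig_two_smul_of_v_slope (hT : IsTateNormalForm T) {x y : v.adicCompletion K}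
    {h : T.toAffine.Nonsingular x y} (hx : Valued.v x < 1) (h2 : 2 * y + x ≠ 0)
    (hΛ : Valued.v ((3 * x ^ 2 - y) / (2 * y + x)) < 1 ∨
      Valued.v ((3 * x ^ 2 - y) / (2 * y + x) + 1) < 1) :
    ¬IsBig T (.some _ _ h + .some _ _ h) := by
  have hy : y ≠ T.toAffine.negY x y := by
    rw [hT.negY]
    intro e
    apply h2
    linear_combination e
  rw [WeierstrassCurve.Affine.Point.add_self_of_Y_ne hy, isBig_some, not_le, hT.addX,
    WeierstrassCurve.Affine.slope_of_Y_ne rfl hy, hT.negY, hT.a₁, hT.a₂, hT.a₄]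
  have hL : (3 * x ^ 2 + 2 * 0 * x + 0 - 1 * y) / (y - (-y - x)) =
      (3 * x ^ 2 - y) / (2 * y + x) := by
    congr 1 <;> ring
  rw [hL]
  exact Valuation.map_sub_lt _ (Valuation.map_sub_lt _ (v_sq_add_self_lt_one hΛ) hx) hx

/-! ### Valuation estimates for the chords through the representatives -/

/-- If `|N| < |D|` then `|N / D| < 1`. [folklore] -/
theorem v_div_lt_one {N D : v.adicCompletion K} (h : Valued.v N < Valued.v D) :
    Valued.v (N / D) < 1 := by
  have hD : 0 < Valued.v D := lt_of_le_of_lt zero_le h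
  rwa [Valuation.map_div, div_lt_one₀ hD]

/-- For `0 < |ϖ| < 1`, `|a| < 1`, `|b| ≤ 1` and `m < m'`: `|ϖᵐ a + ϖ^{m'} b| < |ϖ|ᵐ`. [folklore] -/
theorem v_num_lt {ϖ a b : v.adicCompletion K} (h0 : 0 < Valued.v ϖ) (h1 : Valued.v ϖ < 1)
    (ha : Valued.v a < 1) (hb : Valued.v b ≤ 1) {m m' : ℕ} (hmm' : m < m') :
    Valued.v (ϖ ^ m * a + ϖ ^ m' * b) < Valued.v ϖ ^ m := by
  have hpos : 0 < Valued.v ϖ ^ m := pow_pos h0 m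
  refine Valuation.map_add_lt _ ?_ ?_
  · rw [Valuation.map_mul, Valuation.map_pow]
    exact mul_lt_of_le_of_lt_one₀ hpos le_rfl ha
  · rw [Valuation.map_mul, Valuation.map_pow]
    calc Valued.v ϖ ^ m' * Valued.v b ≤ Valued.v ϖ ^ m' * 1 := mul_le_mul_right hb _
      _ = Valued.v ϖ ^ m' := mul_one _
      _ < Valued.v ϖ ^ m := pow_lt_pow_right_of_lt_one₀ h0 h1 hmm'

/-- For `0 < |ϖ| < 1`, `|e| ≤ 1` and `m < m'`: `|ϖᵐ − ϖ^{m'} e| = |ϖ|ᵐ`. [folklore] -/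
theorem v_den_eq {ϖ e : v.adicCompletion K} (h0 : 0 < Valued.v ϖ) (h1 : Valued.v ϖ < 1)
    (he : Valued.v e ≤ 1) {m m' : ℕ} (hmm' : m < m') :
    Valued.v (ϖ ^ m - ϖ ^ m' * e) = Valued.v ϖ ^ m := by
  rw [← Valuation.map_pow]
  refine Valuation.map_sub_eq_of_lt_left _ ?_
  rw [Valuation.map_mul, Valuation.map_pow, Valuation.map_pow]
  calc Valued.v ϖ ^ m' * Valued.v e ≤ Valued.v ϖ ^ m' * 1 := mul_le_mul_right he _
    _ = Valued.v ϖ ^ m' := mul_one _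
    _ < Valued.v ϖ ^ m := pow_lt_pow_right_of_lt_one₀ h0 h1 hmm'

/-- For `0 < |ϖ| < 1` and `1 ≤ m`: `|ϖᵐ| < 1`. [folklore] -/
theorem v_pow_lt_one {ϖ : v.adicCompletion K} (h1 : Valued.v ϖ < 1) {m : ℕ} (hm : 1 ≤ m) :
    Valued.v (ϖ ^ m) < 1 := by
  rw [Valuation.map_pow]
  exact pow_lt_one₀ zero_le h1 (by omega)

/-- For `0 < |ϖ| < 1` and `m < m'`, `|e| ≤ 1`: `ϖᵐ ≠ ϖ^{m'} e`. [folklore] -/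
theorem pow_ne_pow_mul {ϖ e : v.adicCompletion K} (h0 : 0 < Valued.v ϖ) (h1 : Valued.v ϖ < 1)
    (he : Valued.v e ≤ 1) {m m' : ℕ} (hmm' : m < m') : ϖ ^ m ≠ ϖ ^ m' * e := by
  intro h
  have h' := v_den_eq h0 h1 he hmm'
  rw [h, sub_self, Valuation.map_zero] at h'
  exact (pow_pos h0 m).ne h'

/-! ### Pairwise incongruence of the representatives

The representatives are `Q = (ϖᵐ, ϖᵐ z)` with `|z| < 1` (`1 ≤ m < n/2`), their negatives, and
(for `n = 2M`) `Q_W = (ϖᴹ w, ϖᴹ)` with `|w| ≤ 1`; the following lemmas show that the relevant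
sums and differences are small, by the chord and tangent tests. Compare Silverman, *ATAEC*, V.4,
Lemmas 4.1.2–4.1.4 (the sets `U_n, V_n, W`). -/

/-- `Q_m − Q_{m'}` is small for `m < m'`: the chord through `(ϖᵐ, ϖᵐz)` and
`−(ϖ^{m'}, ϖ^{m'}z') = (ϖ^{m'}, −ϖ^{m'}z' − ϖ^{m'})` has slope
`(z + ϖ^{m'−m}(z' + 1))/(1 − ϖ^{m'−m}) ∈ 𝔪`. [folklore] -/
theorem not_isBig_repQ_sub_repQ (hT : IsTateNormalForm T) {ϖ z z' : v.adicCompletion K}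
    (h0 : 0 < Valued.v ϖ) (h1 : Valued.v ϖ < 1) (hz : Valued.v z < 1) (hz' : Valued.v z' ≤ 1)
    {m m' : ℕ} (hm : 1 ≤ m) (hmm' : m < m')
    {h₁ : T.toAffine.Nonsingular (ϖ ^ m) (ϖ ^ m * z)}
    {h₂ : T.toAffine.Nonsingular (ϖ ^ m') (ϖ ^ m' * z')} :
    ¬IsBig T (.some _ _ h₁ - .some _ _ h₂) := by
  rw [sub_eq_add_neg, WeierstrassCurve.Affine.Point.neg_some]
  have hne : ϖ ^ m ≠ ϖ ^ m' := by
    simpa only [mul_one] using pow_ne_pow_mul h0 h1 (le_of_eq (Valuation.map_one _)) hmm'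
  refine not_isBig_add_of_v_slope hT (v_pow_lt_one h1 hm) (v_pow_lt_one h1 (by omega)) hne
    (Or.inl ?_)
  rw [hT.negY]
  have e1 : ϖ ^ m * z - (-(ϖ ^ m' * z') - ϖ ^ m') = ϖ ^ m * z + ϖ ^ m' * (z' + 1) := by ring
  have e2 : ϖ ^ m - ϖ ^ m' = ϖ ^ m - ϖ ^ m' * 1 := by ring
  rw [e1, e2]
  refine v_div_lt_one ?_
  rw [v_den_eq h0 h1 (le_of_eq (Valuation.map_one _)) hmm']
  exact v_num_lt h0 h1 hz (Valuation.map_add_le _ hz' (le_of_eq (Valuation.map_one _))) hmm'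

/-- `Q_m + Q_{m'}` is small for `m < m'`: the chord through `(ϖᵐ, ϖᵐz)` and
`(ϖ^{m'}, ϖ^{m'}z')` has slope `(z − ϖ^{m'−m}z')/(1 − ϖ^{m'−m}) ∈ 𝔪`. [folklore] -/
theorem not_isBig_repQ_add_repQ (hT : IsTateNormalForm T) {ϖ z z' : v.adicCompletion K}
    (h0 : 0 < Valued.v ϖ) (h1 : Valued.v ϖ < 1) (hz : Valued.v z < 1) (hz' : Valued.v z' ≤ 1)
    {m m' : ℕ} (hm : 1 ≤ m) (hmm' : m < m')
    {h₁ : T.toAffine.Nonsingular (ϖ ^ m) (ϖ ^ m * z)}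
    {h₂ : T.toAffine.Nonsingular (ϖ ^ m') (ϖ ^ m' * z')} :
    ¬IsBig T (.some _ _ h₁ + .some _ _ h₂) := by
  have hne : ϖ ^ m ≠ ϖ ^ m' := by
    simpa only [mul_one] using pow_ne_pow_mul h0 h1 (le_of_eq (Valuation.map_one _)) hmm'
  refine not_isBig_add_of_v_slope hT (v_pow_lt_one h1 hm) (v_pow_lt_one h1 (by omega)) hne
    (Or.inl ?_)
  have e1 : ϖ ^ m * z - ϖ ^ m' * z' = ϖ ^ m * z + ϖ ^ m' * (-z') := by ring
  have e2 : ϖ ^ m - ϖ ^ m' = ϖ ^ m - ϖ ^ m' * 1 := by ring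
  rw [e1, e2]
  refine v_div_lt_one ?_
  rw [v_den_eq h0 h1 (le_of_eq (Valuation.map_one _)) hmm']
  refine v_num_lt h0 h1 hz ?_ hmm'
  rwa [Valuation.map_neg]

/-- `2 Q_m` is small: the tangent at `(ϖᵐ, ϖᵐz)` has slope `(3ϖᵐ − z)/(2z + 1) ∈ 𝔪`.
[folklore] -/
theorem not_isBig_repQ_add_self (hT : IsTateNormalForm T) {ϖ z : v.adicCompletion K}
    (h0 : 0 < Valued.v ϖ) (h1 : Valued.v ϖ < 1) (hz : Valued.v z < 1) {m : ℕ} (hm : 1 ≤ m)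
    {h₁ : T.toAffine.Nonsingular (ϖ ^ m) (ϖ ^ m * z)} :
    ¬IsBig T (.some _ _ h₁ + .some _ _ h₁) := by
  have h2z : Valued.v (2 * z) < 1 := by
    rw [Valuation.map_mul]
    calc Valued.v 2 * Valued.v z ≤ 1 * Valued.v z := mul_le_mul_left v_two_le_one _
      _ = Valued.v z := one_mul _
      _ < 1 := hz
  have hden : Valued.v (2 * (ϖ ^ m * z) + ϖ ^ m) = Valued.v ϖ ^ m := by
    have e : 2 * (ϖ ^ m * z) + ϖ ^ m = ϖ ^ m * (1 + 2 * z) := by ring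
    rw [e, Valuation.map_mul, Valuation.map_pow, Valuation.map_one_add_of_lt _ h2z, mul_one]
  have hden0 : 2 * (ϖ ^ m * z) + ϖ ^ m ≠ 0 := by
    intro h
    rw [h, Valuation.map_zero] at hden
    exact (pow_pos h0 m).ne hden
  refine not_isBig_two_smul_of_v_slope hT (v_pow_lt_one h1 hm) hden0 (Or.inl ?_)
  refine v_div_lt_one ?_
  rw [hden]
  have e1 : 3 * (ϖ ^ m) ^ 2 - ϖ ^ m * z = ϖ ^ m * (-z) + ϖ ^ (2 * m) * 3 := by ring
  rw [e1]
  refine v_num_lt h0 h1 (by rwa [Valuation.map_neg]) ?_ (by omega)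
  have e3 : (3 : v.adicCompletion K) = ((3 : v.adicCompletionIntegers K) : v.adicCompletion K) :=
    rfl
  rw [e3]
  exact v_coe_le_one _

/-- For `|ϖ| < 1`, `|w| ≤ 1` and `1 ≤ M`: `|ϖᴹ w| < 1`. [folklore] -/
theorem v_pow_mul_lt_one {ϖ w : v.adicCompletion K} (h1 : Valued.v ϖ < 1) (hw : Valued.v w ≤ 1)
    {M : ℕ} (hM : 1 ≤ M) : Valued.v (ϖ ^ M * w) < 1 := by
  rw [Valuation.map_mul, Valuation.map_pow]
  calc Valued.v ϖ ^ M * Valued.v w ≤ Valued.v ϖ ^ M * 1 := mul_le_mul_right hw _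
    _ = Valued.v ϖ ^ M := mul_one _
    _ < 1 := pow_lt_one₀ zero_le h1 (by omega)

/-- `Q_m − Q_W` is small for `m < M`: the chord through `(ϖᵐ, ϖᵐz)` and
`−(ϖᴹw, ϖᴹ) = (ϖᴹw, −ϖᴹ − ϖᴹw)` has slope `(z + ϖ^{M−m}(1 + w))/(1 − ϖ^{M−m}w) ∈ 𝔪`.
[folklore] -/
theorem not_isBig_repQ_sub_repW (hT : IsTateNormalForm T) {ϖ z w : v.adicCompletion K}
    (h0 : 0 < Valued.v ϖ) (h1 : Valued.v ϖ < 1) (hz : Valued.v z < 1) (hw : Valued.v w ≤ 1)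
    {m M : ℕ} (hm : 1 ≤ m) (hmM : m < M)
    {h₁ : T.toAffine.Nonsingular (ϖ ^ m) (ϖ ^ m * z)}
    {h₂ : T.toAffine.Nonsingular (ϖ ^ M * w) (ϖ ^ M)} :
    ¬IsBig T (.some _ _ h₁ - .some _ _ h₂) := by
  rw [sub_eq_add_neg, WeierstrassCurve.Affine.Point.neg_some]
  refine not_isBig_add_of_v_slope hT (v_pow_lt_one h1 hm) (v_pow_mul_lt_one h1 hw (by omega))
    (pow_ne_pow_mul h0 h1 hw hmM) (Or.inl ?_)
  rw [hT.negY]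
  have e1 : ϖ ^ m * z - (-ϖ ^ M - ϖ ^ M * w) = ϖ ^ m * z + ϖ ^ M * (1 + w) := by ring
  rw [e1]
  refine v_div_lt_one ?_
  rw [v_den_eq h0 h1 hw hmM]
  exact v_num_lt h0 h1 hz (Valuation.map_add_le _ (le_of_eq (Valuation.map_one _)) hw) hmM

/-- `Q_m + Q_W` is small for `m < M`: the chord through `(ϖᵐ, ϖᵐz)` and `(ϖᴹw, ϖᴹ)` has
slope `(z − ϖ^{M−m})/(1 − ϖ^{M−m}w) ∈ 𝔪`. [folklore] -/
theorem not_isBig_repQ_add_repW (hT : IsTateNormalForm T) {ϖ z w : v.adicCompletion K}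
    (h0 : 0 < Valued.v ϖ) (h1 : Valued.v ϖ < 1) (hz : Valued.v z < 1) (hw : Valued.v w ≤ 1)
    {m M : ℕ} (hm : 1 ≤ m) (hmM : m < M)
    {h₁ : T.toAffine.Nonsingular (ϖ ^ m) (ϖ ^ m * z)}
    {h₂ : T.toAffine.Nonsingular (ϖ ^ M * w) (ϖ ^ M)} :
    ¬IsBig T (.some _ _ h₁ + .some _ _ h₂) := by
  refine not_isBig_add_of_v_slope hT (v_pow_lt_one h1 hm) (v_pow_mul_lt_one h1 hw (by omega))
    (pow_ne_pow_mul h0 h1 hw hmM) (Or.inl ?_)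
  have e1 : ϖ ^ m * z - ϖ ^ M = ϖ ^ m * z + ϖ ^ M * (-1) := by ring
  rw [e1]
  refine v_div_lt_one ?_
  rw [v_den_eq h0 h1 hw hmM]
  refine v_num_lt h0 h1 hz ?_ hmM
  rw [Valuation.map_neg, Valuation.map_one]

/-! ### The representatives (Hensel's lemma) -/

/-- The discriminant of a curve in Tate normal form: `Δ = −a₆(1 + 432a₆)`. [folklore] -/
theorem IsTateNormalForm.Δ_eq (hT : IsTateNormalForm T) : T.Δ = -(T.a₆ * (1 + 432 * T.a₆)) := by
  simp only [WeierstrassCurve.Δ, WeierstrassCurve.b₂, WeierstrassCurve.b₄, WeierstrassCurve.b₆,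
    WeierstrassCurve.b₈, hT.a₁, hT.a₂, hT.a₃, hT.a₄]
  ring

/-- A curve in Tate normal form with `a₆ ≠ 0` is smooth: `Δ = −a₆(1 + 432a₆)` and `1 + 432a₆`
is a unit of `O_v`. [folklore] -/
theorem IsTateNormalForm.Δ_ne_zero (hT : IsTateNormalForm T) (ha : T.a₆ ≠ 0) : T.Δ ≠ 0 := by
  rw [hT.Δ_eq, neg_ne_zero]
  refine mul_ne_zero ha fun h0 => ?_
  have h432 : Valued.v ((432 : v.adicCompletion K) * T.a₆) < 1 := by
    rw [Valuation.map_mul]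
    have e : (432 : v.adicCompletion K) =
        ((432 : v.adicCompletionIntegers K) : v.adicCompletion K) := rfl
    calc Valued.v (432 : v.adicCompletion K) * Valued.v T.a₆ ≤ 1 * Valued.v T.a₆ :=
          mul_le_mul_left (by rw [e]; exact v_coe_le_one _) _
      _ = Valued.v T.a₆ := one_mul _
      _ < 1 := hT.v_a₆
  have h1 := Valuation.map_one_add_of_lt Valued.v h432
  rw [h0, Valuation.map_zero] at h1
  exact zero_ne_one h1

/-- On a curve in Tate normal form with `a₆ ≠ 0` every point of the curve is nonsingular.
[folklore] -/
theorem IsTateNormalForm.nonsingular (hT : IsTateNormalForm T) (ha : T.a₆ ≠ 0)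
    {x y : v.adicCompletion K} (h : y ^ 2 + x * y = x ^ 3 + T.a₆) :
    T.toAffine.Nonsingular x y :=
  (WeierstrassCurve.Affine.equation_iff_nonsingular_of_Δ_ne_zero (hT.Δ_ne_zero ha)).mp
    ((hT.equation_iff x y).mpr h)

section Representatives

open Polynomial

variable {ϖ : v.adicCompletionIntegers K} {α : (v.adicCompletionIntegers K)ˣ} {n : ℕ}

/-- `a₆ = αϖⁿ ≠ 0`. [folklore] -/
theorem a₆_ne_zero (hϖ : Irreducible ϖ)
    (ha : T.a₆ = (((α : v.adicCompletionIntegers K) * ϖ ^ n : v.adicCompletionIntegers K) :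
      v.adicCompletion K)) : T.a₆ ≠ 0 := by
  rw [ha]
  push_cast
  exact mul_ne_zero (fun h => α.ne_zero (Subtype.ext h))
    (pow_ne_zero _ fun h => hϖ.ne_zero (Subtype.ext h))

/-- **The representatives `Q_m`** (`1 ≤ m < n/2`): a point `(ϖᵐ, ϖᵐz)` of
`y² + xy = x³ + αϖⁿ` with `z ∈ 𝔪`, obtained from Hensel's lemma for the monic equation
`z² + z = ϖᵐ + αϖ^{n−2m}` (`z̄ = 0` is a simple root of `z² + z`). This is a point of the piece
`V_m = {|x + y| = |ϖ|ᵐ > |y|}` of Silverman, *ATAEC*, V.4, Lemma 4.1.2. [folklore] -/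
theorem exists_repQ (hT : IsTateNormalForm T) (hϖ : Irreducible ϖ)
    (ha : T.a₆ = (((α : v.adicCompletionIntegers K) * ϖ ^ n : v.adicCompletionIntegers K) :
      v.adicCompletion K)) {m : ℕ} (hm : 1 ≤ m) (hmn : 2 * m < n) :
    ∃ z : v.adicCompletionIntegers K, Valued.v (z : v.adicCompletion K) < 1 ∧
      T.toAffine.Nonsingular ((ϖ : v.adicCompletion K) ^ m)
        ((ϖ : v.adicCompletion K) ^ m * z) := by
  obtain ⟨d, hd⟩ : ∃ d, n = 2 * m + (d + 1) := ⟨n - 2 * m - 1, by omega⟩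
  have hϖm : ϖ ∈ maximalIdeal (v.adicCompletionIntegers K) :=
    (mem_maximalIdeal _).mpr (mem_nonunits_iff.mpr hϖ.not_isUnit)
  set c : v.adicCompletionIntegers K := ϖ ^ m + α * ϖ ^ (d + 1) with hc
  have hcm : c ∈ maximalIdeal (v.adicCompletionIntegers K) :=
    add_mem (Ideal.pow_mem_of_mem _ hϖm m hm)
      (Ideal.mul_mem_left _ _ (Ideal.pow_mem_of_mem _ hϖm _ d.succ_pos))
  set f : (v.adicCompletionIntegers K)[X] := X ^ 2 + X - C c with hf
  have hmonic : f.Monic := by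
    have e : f = X ^ 2 + (X - C c) := by rw [hf]; ring
    rw [e]
    refine (monic_X_pow 2).add_of_left ?_
    rw [degree_X_pow, degree_X_sub_C]
    norm_num
  obtain ⟨z, hz, hz0⟩ := HenselianLocalRing.is_henselian f hmonic 0
    (by simpa [hf] using neg_mem hcm) (by simp [hf])
  rw [sub_zero] at hz0
  refine ⟨z, (mem_maximalIdeal_iff_v_lt_one z).mp hz0, hT.nonsingular (a₆_ne_zero hϖ ha) ?_⟩
  have hzK : (z : v.adicCompletion K) ^ 2 + z - (ϖ ^ m + α * ϖ ^ (d + 1)) = 0 := by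
    have h := hz
    simp only [hf, IsRoot.def, eval_sub, eval_add, eval_pow, eval_X, eval_C, hc] at h
    exact_mod_cast congrArg ((↑) : v.adicCompletionIntegers K → v.adicCompletion K) h
  rw [ha, hd]
  push_cast
  linear_combination ((ϖ : v.adicCompletion K) ^ m) ^ 2 * hzK

/-- **The representative `Q_W`** (`n = 2M`, `M ≥ 1`): a point `(ϖᴹw, ϖᴹ)` of
`y² + xy = x³ + αϖ²ᴹ` with `w ∈ O_v`, obtained from the non-monic Hensel's lemma
(`HenselianLocalRing.exists_isRoot_of_isUnit_derivative`) for `ϖᴹw³ − w + (α − 1) = 0` at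
`w₀ = α − 1`. This is a point of the piece `W = {|y| = |x + y| = |ϖ|ᴹ}` of Silverman, *ATAEC*,
V.4, Lemma 4.1.2 (`w + 1 ≡ α ≢ 0`). [folklore] -/
theorem exists_repW (hT : IsTateNormalForm T) (hϖ : Irreducible ϖ)
    (ha : T.a₆ = (((α : v.adicCompletionIntegers K) * ϖ ^ n : v.adicCompletionIntegers K) :
      v.adicCompletion K)) {M : ℕ} (hM : 1 ≤ M) (hMn : n = 2 * M) :
    ∃ w : v.adicCompletionIntegers K,
      T.toAffine.Nonsingular ((ϖ : v.adicCompletion K) ^ M * w)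
        ((ϖ : v.adicCompletion K) ^ M) := by
  have hϖm : ϖ ∈ maximalIdeal (v.adicCompletionIntegers K) :=
    (mem_maximalIdeal _).mpr (mem_nonunits_iff.mpr hϖ.not_isUnit)
  have hϖM : ϖ ^ M ∈ maximalIdeal (v.adicCompletionIntegers K) := Ideal.pow_mem_of_mem _ hϖm M hM
  set a₀ : v.adicCompletionIntegers K := α - 1 with ha₀
  set f : (v.adicCompletionIntegers K)[X] := C (ϖ ^ M) * X ^ 3 - X + C a₀ with hf
  have h₁ : f.eval a₀ ∈ maximalIdeal (v.adicCompletionIntegers K) := by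
    have e : f.eval a₀ = ϖ ^ M * a₀ ^ 3 := by
      simp only [hf, eval_add, eval_sub, eval_mul, eval_C, eval_pow, eval_X]
      ring
    rw [e]
    exact Ideal.mul_mem_right _ _ hϖM
  have h₂ : IsUnit (f.derivative.eval a₀) := by
    have e : f.derivative.eval a₀ = -(1 - ϖ ^ M * (3 * a₀ ^ 2)) := by
      simp only [hf, derivative_add, derivative_sub, derivative_mul, derivative_C, zero_mul,
        derivative_X_pow, derivative_X, eval_sub, eval_mul, eval_C, eval_pow, eval_X,
        eval_one, eval_natCast, zero_add, map_natCast, add_zero]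
      push_cast
      ring
    rw [e]
    exact (isUnit_one_sub_self_of_mem_nonunits _
      (mem_nonunits_iff.mpr fun hu => (mem_nonunits_iff.mp ((mem_maximalIdeal _).mp
        (Ideal.mul_mem_right _ _ hϖM))) hu)).neg
  obtain ⟨w, hw, -⟩ := HenselianLocalRing.exists_isRoot_of_isUnit_derivative f a₀ h₁ h₂
  refine ⟨w, hT.nonsingular (a₆_ne_zero hϖ ha) ?_⟩
  have hwK : (ϖ : v.adicCompletion K) ^ M * w ^ 3 - w + (α - 1) = 0 := by
    have h := hw
    simp only [hf, IsRoot.def, eval_sub, eval_add, eval_mul, eval_pow, eval_X, eval_C, ha₀] at h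
    exact_mod_cast congrArg ((↑) : v.adicCompletionIntegers K → v.adicCompletion K) h
  rw [ha, hMn]
  push_cast
  linear_combination (-((ϖ : v.adicCompletion K) ^ M) ^ 2) * hwK

/-! ### `n` pairwise incongruent points -/

/-- **Lower bound for `E(K_v)/E₀(K_v)` in the split multiplicative case.** On
`T : y² + xy = x³ + αϖⁿ` over `K_v` (`α ∈ O_vˣ`, `ϖ` a uniformiser of `O_v`, `n ≥ 1`) there are
`n` points pairwise incongruent modulo big points (differences of distinct ones are not big):
`𝒪`, the points `Q_m = (ϖᵐ, ϖᵐz_m)` and `−Q_m` for `1 ≤ m < n/2`, and, for `n` even,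
`Q_W = (ϖ^{n/2}w, ϖ^{n/2})`; `1 + 2⌊(n−1)/2⌋ + [n even] = n`. Together with the reverse
inequality `#E_q(K)/E_{q,0}(K) ≤ v(q)` (Silverman, *ATAEC*, V.4, Prop. 4.1) this is
`E(K)/E₀(K) ≅ ℤ/nℤ`, `n = v(Δ)`, for split multiplicative reduction (Kodaira–Néron; Tate:
*ATAEC*, Cor. IV.9.2(d) and Rem. IV.9.6, `E(K)/E₀(K) ≅ K*/qᶻR* → ℤ/nℤ`); only the lower bound
is needed for the named fact `Literature.NumberTheory.EllipticCurves.rationalComponents_eq_card_of_hasSplitMultiplicativeReductionAt`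
(`NeronModelProofs`: the quotient embeds in a group of order `n`).
[cite: SilvermanATAEC1994, Cor. IV.9.2(d) (PDF p. 340) and Rem. IV.9.6 (PDF p. 355)] -/
theorem exists_fin_forall_isBig_sub_imp_eq (hT : IsTateNormalForm T) (hϖ : Irreducible ϖ)
    (ha : T.a₆ = (((α : v.adicCompletionIntegers K) * ϖ ^ n : v.adicCompletionIntegers K) :
      v.adicCompletion K)) (hn : 1 ≤ n) :
    ∃ f : Fin n → T.toAffine.Point, ∀ i j, IsBig T (f i - f j) → i = j := by
  -- valuation of the uniformiser
  have h1 : Valued.v (ϖ : v.adicCompletion K) < 1 :=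
    (integers_adicCompletionIntegers K v).valuation_irreducible_lt_one hϖ
  have h0 : 0 < Valued.v (ϖ : v.adicCompletion K) := by
    rw [zero_lt_iff, ne_eq, Valuation.zero_iff]
    exact fun h => hϖ.ne_zero (Subtype.ext h)
  -- the index set `Option (Fin k ⊕ Fin k ⊕ Fin r)`, `n = 1 + 2k + r`, `r ∈ {0, 1}`
  set k : ℕ := (n - 1) / 2 with hk
  set r : ℕ := (n - 1) % 2 with hr
  have hkr : 2 * k + r + 1 = n := by omega
  -- the representatives `Q_{i+1}` and (for `r = 1`, `n = 2(k+1)`) `Q_W`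
  have hQ : ∀ i : Fin k, ∃ z : v.adicCompletionIntegers K, Valued.v (z : v.adicCompletion K) < 1 ∧
      T.toAffine.Nonsingular ((ϖ : v.adicCompletion K) ^ (i.1 + 1))
        ((ϖ : v.adicCompletion K) ^ (i.1 + 1) * z) :=
    fun i => exists_repQ hT hϖ ha (Nat.succ_pos _) (by omega)
  choose z hz hQns using hQ
  have hW : ∀ _j : Fin r, ∃ w : v.adicCompletionIntegers K,
      T.toAffine.Nonsingular ((ϖ : v.adicCompletion K) ^ (k + 1) * w)
        ((ϖ : v.adicCompletion K) ^ (k + 1)) :=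
    fun j => exists_repW hT hϖ ha (Nat.succ_pos _) (by have := j.2; omega)
  choose w hWns using hW
  -- smallness of the representatives and of the relevant sums and differences
  have smallQ : ∀ i, ¬IsBig T (.some _ _ (hQns i)) := fun i => by
    rw [isBig_some, not_le]
    exact v_pow_lt_one h1 (Nat.succ_pos _)
  have smallW : ∀ j, ¬IsBig T (.some _ _ (hWns j)) := fun j => by
    rw [isBig_some, not_le]
    exact v_pow_mul_lt_one h1 (v_coe_le_one _) (Nat.succ_pos _)
  have QQsub : ∀ i i', i ≠ i' → ¬IsBig T (.some _ _ (hQns i) - .some _ _ (hQns i')) := by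
    intro i i' hne
    rcases Nat.lt_or_gt_of_ne (Fin.val_ne_of_ne hne) with hlt | hgt
    · exact not_isBig_repQ_sub_repQ hT h0 h1 (hz i) (hz i').le (Nat.succ_pos _) (by omega)
    · rw [← neg_sub, isBig_neg_iff]
      exact not_isBig_repQ_sub_repQ hT h0 h1 (hz i') (hz i).le (Nat.succ_pos _) (by omega)
  have QQadd : ∀ i i', ¬IsBig T (.some _ _ (hQns i) + .some _ _ (hQns i')) := by
    intro i i'
    rcases lt_trichotomy i.1 i'.1 with hlt | heq | hgt
    · exact not_isBig_repQ_add_repQ hT h0 h1 (hz i) (hz i').le (Nat.succ_pos _) (by omega)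
    · have hii' : i = i' := Fin.ext heq
      subst hii'
      exact not_isBig_repQ_add_self hT h0 h1 (hz i) (Nat.succ_pos _)
    · rw [add_comm]
      exact not_isBig_repQ_add_repQ hT h0 h1 (hz i') (hz i).le (Nat.succ_pos _) (by omega)
  have QWsub : ∀ i j, ¬IsBig T (.some _ _ (hQns i) - .some _ _ (hWns j)) := fun i j =>
    not_isBig_repQ_sub_repW hT h0 h1 (hz i) (v_coe_le_one _) (Nat.succ_pos _) (by omega)
  have QWadd : ∀ i j, ¬IsBig T (.some _ _ (hQns i) + .some _ _ (hWns j)) := fun i j =>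
    not_isBig_repQ_add_repW hT h0 h1 (hz i) (v_coe_le_one _) (Nat.succ_pos _) (by omega)
  -- the map and its injectivity modulo big points
  set rep : Option (Fin k ⊕ (Fin k ⊕ Fin r)) → T.toAffine.Point := fun o =>
    o.elim 0 (Sum.elim (fun i => .some _ _ (hQns i))
      (Sum.elim (fun i => -.some _ _ (hQns i)) (fun j => .some _ _ (hWns j)))) with hrep
  have key : ∀ a b, IsBig T (rep a - rep b) → a = b := by
    rintro (_ | i | i | j) (_ | i' | i' | j') h <;>
      simp only [hrep, Option.elim_none, Option.elim_some, Sum.elim_inl, Sum.elim_inr] at h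
    · rfl
    · rw [zero_sub, isBig_neg_iff] at h
      exact absurd h (smallQ i')
    · rw [zero_sub, neg_neg] at h
      exact absurd h (smallQ i')
    · rw [zero_sub, isBig_neg_iff] at h
      exact absurd h (smallW j')
    · rw [sub_zero] at h
      exact absurd h (smallQ i)
    · by_cases hii' : i = i'
      · rw [hii']
      · exact absurd h (QQsub i i' hii')
    · rw [sub_neg_eq_add] at h
      exact absurd h (QQadd i i')
    · exact absurd h (QWsub i j')
    · rw [sub_zero, isBig_neg_iff] at h
      exact absurd h (smallQ i)
    · rw [← neg_add', isBig_neg_iff] at h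
      exact absurd h (QQadd i i')
    · rw [sub_neg_eq_add, neg_add_eq_sub] at h
      by_cases hii' : i = i'
      · rw [hii']
      · exact absurd h (QQsub i' i (Ne.symm hii'))
    · rw [← neg_add', isBig_neg_iff] at h
      exact absurd h (QWadd i j')
    · rw [sub_zero] at h
      exact absurd h (smallW j)
    · rw [← neg_sub, isBig_neg_iff] at h
      exact absurd h (QWsub i' j)
    · rw [sub_neg_eq_add, add_comm] at h
      exact absurd h (QWadd i' j)
    · have hjj' : j = j' := Fin.ext (by have := j.2; have := j'.2; omega)
      rw [hjj']
  have hcard : Fintype.card (Option (Fin k ⊕ (Fin k ⊕ Fin r))) = n := by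
    simp only [Fintype.card_option, Fintype.card_sum, Fintype.card_fin]
    omega
  let e : Fin n ≃ Option (Fin k ⊕ (Fin k ⊕ Fin r)) := (Fintype.equivFinOfCardEq hcard).symm
  exact ⟨rep ∘ e, fun i j h => e.injective (key _ _ h)⟩

/-- Quotient form: for every subgroup `B` of `T(K_v)` consisting of big points (e.g. the image
of `E₀(K_v)` of the minimal model under the isomorphism with `T(K_v)`), there is an injection
`Fin n ↪ T(K_v)/B`. [folklore] -/
theorem exists_fin_injective_quotient (hT : IsTateNormalForm T) (hϖ : Irreducible ϖ)
    (ha : T.a₆ = (((α : v.adicCompletionIntegers K) * ϖ ^ n : v.adicCompletionIntegers K) :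
      v.adicCompletion K)) (hn : 1 ≤ n)
    (B : AddSubgroup T.toAffine.Point) (hB : ∀ P ∈ B, IsBig T P) :
    ∃ g : Fin n → T.toAffine.Point ⧸ B, Function.Injective g := by
  obtain ⟨f, hf⟩ := exists_fin_forall_isBig_sub_imp_eq hT hϖ ha hn
  refine ⟨fun i => (f i : T.toAffine.Point ⧸ B), fun i j h => ?_⟩
  have h' := hB _ (QuotientAddGroup.eq.mp h)
  rw [neg_add_eq_sub] at h'
  exact (hf j i h').symm

end Representatives

end NormalForm

end TateNormalForm

end Literature.NumberTheory.EllipticCurves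

end
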